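import Mathlib
import Summits.Ventures.PercRepro2.Defs
import Summits.Ventures.PercRepro2.Independence
import Summits.Ventures.PercRepro2.Harris
import Summits.Ventures.PercRepro2.Graph
import Summits.Ventures.PercRepro2.Exploration
import Summits.Ventures.PercRepro2.FourFunctions
import Summits.Ventures.PercRepro2.Induced
import Summits.Ventures.PercRepro2.Frontier
import Summits.Ventures.PercRepro2.ObsIndependence
import Summits.Ventures.PercRepro2.BHK
import Summits.Ventures.PercRepro2.BHKAntitone
import Summits.Ventures.PercRepro2.BlockConn
import Summits.Ventures.PercRepro2.ContractedCluster

/-!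
# The antitone van den Berg–Häggström–Kahn inequality for the CONTRACTED cluster
(blind cell PercRepro2, mine-1 g53; paper proofs/MINE1-BLOCKS.md §2.5(d))

`BHKAntitone.lean` (g51): for nonnegative monotone cluster functionals `F₁, F₂` and nonnegative
antitone `D₁, D₂` of the cluster `C_s` of a root, and avoided sets `X, Y`,
`E[(F₁D₁)(C_s) 1_{R_X}] · E[(F₂D₂)(C_s) 1_{R_Y}] ≤ E[(F₁F₂)(C_s) 1_{R_{X∩Y}}] · E[(D₁D₂)(C_s) 1_{R_{X∪Y}}]`.
This file proves the same inequality for the CONTRACTED cluster `C^𝒲_t` of `ContractedCluster.lean`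
(the cluster of `t` with the blocks of a family `𝒲` contracted), with the functionals monotone
resp. antitone on all vertex sets (`bhk_antitone_contracted`).  The proof is the same exploration
induction: when `X ∩ Y = ∅` four Harris inequalities, otherwise the edges around `Z = X ∩ Y` are
explored, the domain Markov identity of `ContractedCluster.lean` turns every term into a sum over
the frontier — the avoided sets gaining the frontier AND the block-mates of `Z` — and the four
functions theorem closes the step.  It is the base-case tool of the block family with blocks on
BOTH sides (several `u`'s and several `w`'s), hence of the anti-`v` pair `NSST·TNTS ≤ NSSS·TNTT`.
-/

namespace Summit.Ventures.PercRepro2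

namespace BlockFamily

section Aux

variable {V : Type*} {E : Type*} [DecidableEq V] {R : Type*} [CommRing R] [LinearOrder R]
  [IsStrictOrderedRing R] {ends : E → Sym2 V} {U : Finset V} {𝒲 : Finset (Finset V)} {t : V}

omit [CommRing R] [IsStrictOrderedRing R] in
/-- A monotone functional is a monotone contracted-cluster observable. -/
lemma monotone_clusterObsB {F : Set V → R} (hF : Monotone F) :
    Monotone (clusterObsB ends U 𝒲 t F) :=
  fun _ _ h => hF (clusterInB_mono h)

omit [CommRing R] [IsStrictOrderedRing R] in
/-- An antitone functional is an antitone contracted-cluster observable. -/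
lemma antitone_clusterObsB {F : Set V → R} (hF : Antitone F) :
    Antitone (clusterObsB ends U 𝒲 t F) :=
  fun _ _ h => hF (clusterInB_mono h)

/-- Nonnegativity of `F(C^𝒲_t) · 1_A` for a nonnegative functional. -/
lemma clusterObsB_mul_indicator_nonneg {F : Set V → R} (hF : ∀ S, 0 ≤ F S)
    (A : Set (Config E)) (ω : Config E) :
    0 ≤ (clusterObsB ends U 𝒲 t F * A.indicator (1 : Config E → R)) ω :=
  mul_nonneg (hF _) (Set.indicator_apply_nonneg fun _ => zero_le_one)

/-- Monotonicity in the event: `E(F(C^𝒲_t) 1_A) ≤ E(F(C^𝒲_t) 1_B)` for `A ⊆ B` and `F ≥ 0`. -/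
lemma expect_clusterObsB_mul_indicator_mono [Fintype E] [DecidableEq E] {p : E → R}
    (hp : IsProbVec p) {F : Set V → R} (hF : ∀ S, 0 ≤ F S) {A B : Set (Config E)} (hAB : A ⊆ B) :
    expect p (clusterObsB ends U 𝒲 t F * A.indicator 1) ≤
      expect p (clusterObsB ends U 𝒲 t F * B.indicator 1) := by
  refine expect_mono hp fun ω => ?_
  simp only [Pi.mul_apply]
  refine mul_le_mul_of_nonneg_left ?_ (hF _)
  by_cases h : ω ∈ A
  · rw [Set.indicator_of_mem h, Set.indicator_of_mem (hAB h)]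
  · rw [Set.indicator_of_notMem h]
    exact Set.indicator_apply_nonneg fun _ => zero_le_one

end Aux

section Main

variable {V : Type*} {E : Type*} [Fintype E] [DecidableEq E] [Fintype V] [DecidableEq V]
  {R : Type*} [CommRing R] [LinearOrder R] [IsStrictOrderedRing R]

omit [Fintype V] in
/-- The case `X ∩ Y = ∅`: Harris' inequality four times. -/
lemma bhk_antitone_contracted_of_inter_eq_empty (p : E → R) (hp : IsProbVec p)
    (ends : E → Sym2 V) (𝒲 : Finset (Finset V)) (t : V) (U : Finset V) {F₁ F₂ D₁ D₂ : Set V → R}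
    (hF₁ : Monotone F₁) (hF₂ : Monotone F₂) (hD₁ : Antitone D₁) (hD₂ : Antitone D₂)
    (hF₁0 : ∀ S, 0 ≤ F₁ S) (hF₂0 : ∀ S, 0 ≤ F₂ S) (hD₁0 : ∀ S, 0 ≤ D₁ S) (hD₂0 : ∀ S, 0 ≤ D₂ S)
    (X Y : Finset V) (hZ : X ∩ Y = ∅) :
    expect p (clusterObsB ends U 𝒲 t (F₁ * D₁) * (REventB ends U 𝒲 t X).indicator 1) *
        expect p (clusterObsB ends U 𝒲 t (F₂ * D₂) * (REventB ends U 𝒲 t Y).indicator 1) ≤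
      expect p (clusterObsB ends U 𝒲 t (F₁ * F₂) * (REventB ends U 𝒲 t (X ∩ Y)).indicator 1) *
        expect p (clusterObsB ends U 𝒲 t (D₁ * D₂) * (REventB ends U 𝒲 t (X ∪ Y)).indicator 1) := by
  rw [hZ, REventB_empty, Set.indicator_univ, mul_one, REventB_union, clusterObsB_mul,
    clusterObsB_mul, clusterObsB_mul, clusterObsB_mul]
  have hRX := isLowerSet_REventB (ends := ends) (U := U) (𝒲 := 𝒲) (t := t) X
  have hRY := isLowerSet_REventB (ends := ends) (U := U) (𝒲 := 𝒲) (t := t) Y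
  set f₁ := clusterObsB ends U 𝒲 t F₁ with hf₁
  set f₂ := clusterObsB ends U 𝒲 t F₂ with hf₂
  set g₁ := clusterObsB ends U 𝒲 t D₁ * (REventB ends U 𝒲 t X).indicator (1 : Config E → R) with hg₁
  set g₂ := clusterObsB ends U 𝒲 t D₂ * (REventB ends U 𝒲 t Y).indicator (1 : Config E → R) with hg₂
  have mf₁ : Monotone f₁ := monotone_clusterObsB hF₁
  have mf₂ : Monotone f₂ := monotone_clusterObsB hF₂
  have aD₁ : Antitone (clusterObsB ends U 𝒲 t D₁) := antitone_clusterObsB hD₁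
  have aD₂ : Antitone (clusterObsB ends U 𝒲 t D₂) := antitone_clusterObsB hD₂
  have nD₁ : ∀ ω, 0 ≤ clusterObsB ends U 𝒲 t D₁ ω := fun ω => hD₁0 _
  have nD₂ : ∀ ω, 0 ≤ clusterObsB ends U 𝒲 t D₂ ω := fun ω => hD₂0 _
  have nI : ∀ (A : Set (Config E)) ω, 0 ≤ A.indicator (1 : Config E → R) ω :=
    fun A ω => Set.indicator_apply_nonneg fun _ => zero_le_one
  have ag₁ : Antitone g₁ :=
    antitone_mul_of_nonneg aD₁ (antitone_indicator_of_isLowerSet hRX) nD₁ (nI _)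
  have ag₂ : Antitone g₂ :=
    antitone_mul_of_nonneg aD₂ (antitone_indicator_of_isLowerSet hRY) nD₂ (nI _)
  have ng₁ : ∀ ω, 0 ≤ g₁ ω := fun ω => mul_nonneg (nD₁ ω) (nI _ ω)
  have ng₂ : ∀ ω, 0 ≤ g₂ ω := fun ω => mul_nonneg (nD₂ ω) (nI _ ω)
  have h1 : expect p (f₁ * g₁) ≤ expect p f₁ * expect p g₁ :=
    expect_mul_le_expect_mul_expect_of_antitone hp mf₁ ag₁
  have h2 : expect p (f₂ * g₂) ≤ expect p f₂ * expect p g₂ :=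
    expect_mul_le_expect_mul_expect_of_antitone hp mf₂ ag₂
  have h3 : expect p f₁ * expect p f₂ ≤ expect p (f₁ * f₂) :=
    expect_mul_expect_le_expect_mul hp mf₁ mf₂
  have h4 : expect p g₁ * expect p g₂ ≤ expect p (g₁ * g₂) :=
    expect_mul_expect_le_expect_mul_of_antitone hp ag₁ ag₂
  have eL₁ : clusterObsB ends U 𝒲 t F₁ * clusterObsB ends U 𝒲 t D₁ *
      (REventB ends U 𝒲 t X).indicator (1 : Config E → R) = f₁ * g₁ := by
    rw [hf₁, hg₁]; ring
  have eL₂ : clusterObsB ends U 𝒲 t F₂ * clusterObsB ends U 𝒲 t D₂ *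
      (REventB ends U 𝒲 t Y).indicator (1 : Config E → R) = f₂ * g₂ := by
    rw [hf₂, hg₂]; ring
  have eR : clusterObsB ends U 𝒲 t D₁ * clusterObsB ends U 𝒲 t D₂ *
      (REventB ends U 𝒲 t X ∩ REventB ends U 𝒲 t Y).indicator (1 : Config E → R) = g₁ * g₂ := by
    rw [hg₁, hg₂]
    ext ω
    simp only [Pi.mul_apply]
    rw [indicator_inter_one]
    ring
  rw [eL₁, eL₂, eR]
  have n1 : 0 ≤ expect p (f₂ * g₂) := expect_nonneg hp fun ω => mul_nonneg (hF₂0 _) (ng₂ ω)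
  have n2 : 0 ≤ expect p f₁ := expect_nonneg hp fun ω => hF₁0 _
  have n3 : 0 ≤ expect p (f₁ * f₂) := expect_nonneg hp fun ω => mul_nonneg (hF₁0 _) (hF₂0 _)
  have n4 : 0 ≤ expect p g₁ := expect_nonneg hp ng₁
  have n5 : 0 ≤ expect p g₂ := expect_nonneg hp ng₂
  calc expect p (f₁ * g₁) * expect p (f₂ * g₂)
      ≤ (expect p f₁ * expect p g₁) * (expect p f₂ * expect p g₂) :=
        mul_le_mul h1 h2 n1 (mul_nonneg n2 n4)
    _ = (expect p f₁ * expect p f₂) * (expect p g₁ * expect p g₂) := by ring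
    _ ≤ expect p (f₁ * f₂) * expect p (g₁ * g₂) :=
        mul_le_mul h3 h4 (mul_nonneg n4 n5) n3

/-- **The antitone BHK inequality for the contracted cluster**: for a block family `𝒲`, a root
`t`, nonnegative functionals `F₁, F₂` monotone and `D₁, D₂` antitone on vertex sets, every vertex
set `U` and `X, Y ⊆ U`,
`E((F₁D₁)(C^𝒲_t) 1_{R_X}) · E((F₂D₂)(C^𝒲_t) 1_{R_Y})
  ≤ E((F₁F₂)(C^𝒲_t) 1_{R_{X∩Y}}) · E((D₁D₂)(C^𝒲_t) 1_{R_{X∪Y}})` on `G[U]`. -/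
theorem bhk_antitone_contracted (p : E → R) (hp : IsProbVec p) (ends : E → Sym2 V)
    (𝒲 : Finset (Finset V)) (t : V) {F₁ F₂ D₁ D₂ : Set V → R}
    (hF₁ : Monotone F₁) (hF₂ : Monotone F₂) (hD₁ : Antitone D₁) (hD₂ : Antitone D₂)
    (hF₁0 : ∀ S, 0 ≤ F₁ S) (hF₂0 : ∀ S, 0 ≤ F₂ S) (hD₁0 : ∀ S, 0 ≤ D₁ S) (hD₂0 : ∀ S, 0 ≤ D₂ S)
    (U : Finset V) :
    ∀ X Y : Finset V, X ⊆ U → Y ⊆ U →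
      expect p (clusterObsB ends U 𝒲 t (F₁ * D₁) * (REventB ends U 𝒲 t X).indicator 1) *
          expect p (clusterObsB ends U 𝒲 t (F₂ * D₂) * (REventB ends U 𝒲 t Y).indicator 1) ≤
        expect p (clusterObsB ends U 𝒲 t (F₁ * F₂) * (REventB ends U 𝒲 t (X ∩ Y)).indicator 1) *
          expect p (clusterObsB ends U 𝒲 t (D₁ * D₂) * (REventB ends U 𝒲 t (X ∪ Y)).indicator 1) := by
  have hFD₁0 : ∀ S, 0 ≤ (F₁ * D₁) S := fun S => mul_nonneg (hF₁0 S) (hD₁0 S)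
  have hFD₂0 : ∀ S, 0 ≤ (F₂ * D₂) S := fun S => mul_nonneg (hF₂0 S) (hD₂0 S)
  have hFF0 : ∀ S, 0 ≤ (F₁ * F₂) S := fun S => mul_nonneg (hF₁0 S) (hF₂0 S)
  have hDD0 : ∀ S, 0 ≤ (D₁ * D₂) S := fun S => mul_nonneg (hD₁0 S) (hD₂0 S)
  induction U using Finset.strongInduction with
  | H U ih =>
  intro X Y hX hY
  by_cases hZ : X ∩ Y = ∅
  · exact bhk_antitone_contracted_of_inter_eq_empty p hp ends 𝒲 t U hF₁ hF₂ hD₁ hD₂ hF₁0 hF₂0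
      hD₁0 hD₂0 X Y hZ
  set Z := X ∩ Y with hZdef
  have hZX : Z ⊆ X := Finset.inter_subset_left
  have hZY : Z ⊆ Y := Finset.inter_subset_right
  have hZU : Z ⊆ U := hZX.trans hX
  by_cases htZ : t ∈ Z
  · -- `t ∈ X`: the left side vanishes
    have h0 : expect p (clusterObsB ends U 𝒲 t (F₁ * D₁) * (REventB ends U 𝒲 t X).indicator 1)
        = 0 := by
      rw [REventB_eq_empty_of_mem (hZX htZ)]
      simp [expect]
    rw [h0, zero_mul]
    exact mul_nonneg (expect_nonneg hp (clusterObsB_mul_indicator_nonneg hFF0 _))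
      (expect_nonneg hp (clusterObsB_mul_indicator_nonneg hDD0 _))
  have hU' : U \ Z ⊂ U := Finset.sdiff_ssubset hZU (Finset.nonempty_iff_ne_empty.2 hZ)
  set M := matesB 𝒲 U Z with hMdef
  have hMU : M ⊆ U \ Z := matesB_subset
  -- the four terms as sums over configurations (domain Markov identity)
  have e1 : expect p (clusterObsB ends U 𝒲 t (F₁ * D₁) * (REventB ends U 𝒲 t X).indicator 1) =
      ∑ ω, weight p ω * expect p (clusterObsB ends (U \ Z) 𝒲 t (F₁ * D₁) *
        (REventB ends (U \ Z) 𝒲 t ((X \ Z) ∪ frontier ends U Z ω ∪ M)).indicator 1) := by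
    rw [← expect_clusterObsB_mul_indicator_eq_sum p ends hZU 𝒲 htZ (F₁ * D₁) (X \ Z),
      Finset.sdiff_union_of_subset hZX]
  have e2 : expect p (clusterObsB ends U 𝒲 t (F₂ * D₂) * (REventB ends U 𝒲 t Y).indicator 1) =
      ∑ ω, weight p ω * expect p (clusterObsB ends (U \ Z) 𝒲 t (F₂ * D₂) *
        (REventB ends (U \ Z) 𝒲 t ((Y \ Z) ∪ frontier ends U Z ω ∪ M)).indicator 1) := by
    rw [← expect_clusterObsB_mul_indicator_eq_sum p ends hZU 𝒲 htZ (F₂ * D₂) (Y \ Z),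
      Finset.sdiff_union_of_subset hZY]
  have e3 : expect p (clusterObsB ends U 𝒲 t (F₁ * F₂) * (REventB ends U 𝒲 t Z).indicator 1) =
      ∑ ω, weight p ω * expect p (clusterObsB ends (U \ Z) 𝒲 t (F₁ * F₂) *
        (REventB ends (U \ Z) 𝒲 t (∅ ∪ frontier ends U Z ω ∪ M)).indicator 1) := by
    rw [← expect_clusterObsB_mul_indicator_eq_sum p ends hZU 𝒲 htZ (F₁ * F₂) ∅, Finset.empty_union]
  have e4 : expect p (clusterObsB ends U 𝒲 t (D₁ * D₂) * (REventB ends U 𝒲 t (X ∪ Y)).indicator 1) =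
      ∑ ω, weight p ω * expect p (clusterObsB ends (U \ Z) 𝒲 t (D₁ * D₂) *
        (REventB ends (U \ Z) 𝒲 t (((X \ Z) ∪ (Y \ Z)) ∪ frontier ends U Z ω ∪ M)).indicator 1) := by
    rw [← expect_clusterObsB_mul_indicator_eq_sum p ends hZU 𝒲 htZ (D₁ * D₂) ((X \ Z) ∪ (Y \ Z)),
      ← Finset.union_sdiff_distrib,
      Finset.sdiff_union_of_subset (hZX.trans Finset.subset_union_left)]
  rw [e1, e2, e3, e4]
  refine four_functions_theorem_univ
    (fun ω => weight p ω * expect p (clusterObsB ends (U \ Z) 𝒲 t (F₁ * D₁) *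
      (REventB ends (U \ Z) 𝒲 t ((X \ Z) ∪ frontier ends U Z ω ∪ M)).indicator 1))
    (fun ω => weight p ω * expect p (clusterObsB ends (U \ Z) 𝒲 t (F₂ * D₂) *
      (REventB ends (U \ Z) 𝒲 t ((Y \ Z) ∪ frontier ends U Z ω ∪ M)).indicator 1))
    (fun ω => weight p ω * expect p (clusterObsB ends (U \ Z) 𝒲 t (F₁ * F₂) *
      (REventB ends (U \ Z) 𝒲 t (∅ ∪ frontier ends U Z ω ∪ M)).indicator 1))
    (fun ω => weight p ω * expect p (clusterObsB ends (U \ Z) 𝒲 t (D₁ * D₂) *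
      (REventB ends (U \ Z) 𝒲 t (((X \ Z) ∪ (Y \ Z)) ∪ frontier ends U Z ω ∪ M)).indicator 1))
    (fun ω => mul_nonneg (weight_nonneg hp ω)
      (expect_nonneg hp (clusterObsB_mul_indicator_nonneg hFD₁0 _)))
    (fun ω => mul_nonneg (weight_nonneg hp ω)
      (expect_nonneg hp (clusterObsB_mul_indicator_nonneg hFD₂0 _)))
    (fun ω => mul_nonneg (weight_nonneg hp ω)
      (expect_nonneg hp (clusterObsB_mul_indicator_nonneg hFF0 _)))
    (fun ω => mul_nonneg (weight_nonneg hp ω)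
      (expect_nonneg hp (clusterObsB_mul_indicator_nonneg hDD0 _))) ?_
  intro ω ω'
  -- induction hypothesis on `U ∖ Z` with the frontiers and the block-mates added
  have hX'' : (X \ Z) ∪ frontier ends U Z ω ∪ M ⊆ U \ Z :=
    Finset.union_subset (Finset.union_subset (Finset.sdiff_subset_sdiff hX (le_refl Z))
      (frontier_subset ω)) hMU
  have hY'' : (Y \ Z) ∪ frontier ends U Z ω' ∪ M ⊆ U \ Z :=
    Finset.union_subset (Finset.union_subset (Finset.sdiff_subset_sdiff hY (le_refl Z))
      (frontier_subset ω')) hMU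
  have hIH := ih (U \ Z) hU' ((X \ Z) ∪ frontier ends U Z ω ∪ M)
    ((Y \ Z) ∪ frontier ends U Z ω' ∪ M) hX'' hY''
  -- `S(ω ⊓ ω') ∪ M ⊆ X'' ∩ Y''`
  have h3 : expect p (clusterObsB ends (U \ Z) 𝒲 t (F₁ * F₂) * (REventB ends (U \ Z) 𝒲 t
      (((X \ Z) ∪ frontier ends U Z ω ∪ M) ∩ ((Y \ Z) ∪ frontier ends U Z ω' ∪ M))).indicator 1) ≤
      expect p (clusterObsB ends (U \ Z) 𝒲 t (F₁ * F₂) *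
        (REventB ends (U \ Z) 𝒲 t (∅ ∪ frontier ends U Z (ω ⊓ ω') ∪ M)).indicator 1) := by
    refine expect_clusterObsB_mul_indicator_mono hp hFF0 (REventB_anti ?_)
    intro x hx
    simp only [Finset.empty_union, Finset.mem_union] at hx
    simp only [Finset.mem_inter, Finset.mem_union]
    rcases hx with hx | hx
    · have := Finset.mem_inter.1 (frontier_inf_subset ω ω' hx)
      exact ⟨Or.inl (Or.inr this.1), Or.inl (Or.inr this.2)⟩
    · exact ⟨Or.inr hx, Or.inr hx⟩
  -- `X'' ∪ Y'' = (X' ∪ Y') ∪ S(ω ⊔ ω') ∪ M`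
  have h4 : expect p (clusterObsB ends (U \ Z) 𝒲 t (D₁ * D₂) * (REventB ends (U \ Z) 𝒲 t
      (((X \ Z) ∪ frontier ends U Z ω ∪ M) ∪ ((Y \ Z) ∪ frontier ends U Z ω' ∪ M))).indicator 1) =
      expect p (clusterObsB ends (U \ Z) 𝒲 t (D₁ * D₂) * (REventB ends (U \ Z) 𝒲 t
        (((X \ Z) ∪ (Y \ Z)) ∪ frontier ends U Z (ω ⊔ ω') ∪ M)).indicator 1) := by
    have hset : ((X \ Z) ∪ frontier ends U Z ω ∪ M) ∪ ((Y \ Z) ∪ frontier ends U Z ω' ∪ M) =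
        ((X \ Z) ∪ (Y \ Z)) ∪ frontier ends U Z (ω ⊔ ω') ∪ M := by
      rw [frontier_sup]
      ext x
      simp only [Finset.mem_union]
      tauto
    rw [hset]
  have n3 : 0 ≤ expect p (clusterObsB ends (U \ Z) 𝒲 t (F₁ * F₂) *
      (REventB ends (U \ Z) 𝒲 t (∅ ∪ frontier ends U Z (ω ⊓ ω') ∪ M)).indicator 1) :=
    expect_nonneg hp (clusterObsB_mul_indicator_nonneg hFF0 _)
  have n4 : 0 ≤ expect p (clusterObsB ends (U \ Z) 𝒲 t (D₁ * D₂) * (REventB ends (U \ Z) 𝒲 t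
      (((X \ Z) ∪ frontier ends U Z ω ∪ M) ∪ ((Y \ Z) ∪ frontier ends U Z ω' ∪ M))).indicator 1) :=
    expect_nonneg hp (clusterObsB_mul_indicator_nonneg hDD0 _)
  calc weight p ω * expect p (clusterObsB ends (U \ Z) 𝒲 t (F₁ * D₁) *
          (REventB ends (U \ Z) 𝒲 t ((X \ Z) ∪ frontier ends U Z ω ∪ M)).indicator 1) *
        (weight p ω' * expect p (clusterObsB ends (U \ Z) 𝒲 t (F₂ * D₂) *
          (REventB ends (U \ Z) 𝒲 t ((Y \ Z) ∪ frontier ends U Z ω' ∪ M)).indicator 1))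
      = (weight p ω * weight p ω') *
          (expect p (clusterObsB ends (U \ Z) 𝒲 t (F₁ * D₁) *
            (REventB ends (U \ Z) 𝒲 t ((X \ Z) ∪ frontier ends U Z ω ∪ M)).indicator 1) *
          expect p (clusterObsB ends (U \ Z) 𝒲 t (F₂ * D₂) *
            (REventB ends (U \ Z) 𝒲 t ((Y \ Z) ∪ frontier ends U Z ω' ∪ M)).indicator 1)) := by
        ring
    _ ≤ (weight p ω * weight p ω') *
          (expect p (clusterObsB ends (U \ Z) 𝒲 t (F₁ * F₂) *
            (REventB ends (U \ Z) 𝒲 t (∅ ∪ frontier ends U Z (ω ⊓ ω') ∪ M)).indicator 1) *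
          expect p (clusterObsB ends (U \ Z) 𝒲 t (D₁ * D₂) *
            (REventB ends (U \ Z) 𝒲 t (((X \ Z) ∪ (Y \ Z)) ∪
              frontier ends U Z (ω ⊔ ω') ∪ M)).indicator 1)) :=
        mul_le_mul_of_nonneg_left (hIH.trans (mul_le_mul h3 (le_of_eq h4) n4 n3))
          (mul_nonneg (weight_nonneg hp ω) (weight_nonneg hp ω'))
    _ = weight p (ω ⊓ ω') * expect p (clusterObsB ends (U \ Z) 𝒲 t (F₁ * F₂) *
          (REventB ends (U \ Z) 𝒲 t (∅ ∪ frontier ends U Z (ω ⊓ ω') ∪ M)).indicator 1) *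
        (weight p (ω ⊔ ω') * expect p (clusterObsB ends (U \ Z) 𝒲 t (D₁ * D₂) *
          (REventB ends (U \ Z) 𝒲 t (((X \ Z) ∪ (Y \ Z)) ∪
            frontier ends U Z (ω ⊔ ω') ∪ M)).indicator 1)) := by
        rw [← weight_inf_mul_weight_sup p ω ω']
        ring

end Main

end BlockFamily

end Summit.Ventures.PercRepro2
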